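import Summits.AtomisticToContinuum.HydrodynamicLimit.Theses.JParityClosure
import Summits.AtomisticToContinuum.HydrodynamicLimit.Theorems.HydroLimitInBand.Negative.ShearReduction

/-!
# Negative knowledge for crux `JParityClosure.OddContactSymmetry` (stmt-AtomisticToContinuum-17722, rev 5):
# "rung ½" — the restated crux contains a frame-free NON-EQUILIBRIUM family: the stationary shear flow, every horizon

Standing disprover `refuter-cdisprove-stmt-AtomisticToContinuum-17722-0` (cycle 1, 2026-08-17), companion of
`Cruxes/OddContactSymmetry/Disproof.lean` §9 and of `RungZeroFrame.lean` (the same for the homogeneous state).  The three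
hypotheses inserted at rev 5 (classical hard-sphere-Euler solution on `[0,T)`, the `t = 0` LLN tie, the shock clock
`τ < T`) are ALL discharged in tree for the isothermal parallel shear profiles `(a₀, u₀, θ₀) = (1, sin(2π x₁) e₀, 1)`:
the stationary shear flow is a classical solution for every `σ` and every `T`
(`HydroLimitInBandNegative.isHardSphereEulerSolution_shear` — all fields depend on `x₁` only, transport is along `e₀`,
the pressure is constant) and it is tied to the local Gibbs laws of these profiles at `t = 0` through every flow family
(`HydroLimitInBandNegative.shear_tied`, data pinning with `rhoLim ≡ 1` at constant activity).  Hence: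

* `OddStatShearAllTimes` — the crux body VERBATIM (Metropolis weight, mollifiers, `F`, `K_N`, quantifier order) at the
  shear profiles with NO frame: every horizon `τ > 0`, `T` never appears;
* `oddContactSymmetry_imp_shearAllTimes : OddContactSymmetry → OddStatShearAllTimes`;
* `not_oddContactSymmetry_of_not_shearAllTimes` — the cheapest GENUINELY NON-EQUILIBRIUM kill recipe that survives the
  restatement, and the designated MD falsifier's exact target: local-Gibbs ∃ η₀ : ℝ, 0 < η₀ ∧ ∃ σ₀ : ℝ, 0 < σ₀ ∧ ∀ σ : ℝ, 0 < σ → σ < σ₀ → ∀ Φ : (N : ℕ) → Literature.Analysis.FluidPDE.HardSphereFlow (Literature.Analysis.FluidPDE.Torus.geometry (Fin 3)) (Literature.MathematicalPhysics.KineticTheory.hsDiameter σ N) (N + 1), ∀ τ : ℝ, 0 < τ → ∀ χ : ℝ × UnitAddTorus (Fin 3) → ℝ, Continuous χ → ∀ g : ℝ → ℝ, Continuous g → (∀ a, η₀ ≤ a → g a = 0) → ∀ Ψ : EuclideanSpace ℝ (Fin 3) × EuclideanSpace ℝ (Fin 3) × EuclideanSpace ℝ (Fin 3) → ℝ, Continuous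 Ψ → (∃ C : ℝ, ∀ q, |Ψ q| ≤ C) → (∀ (n v w : EuclideanSpace ℝ (Fin 3)), ‖n‖ = 1 → Ψ (-n, (Literature.Analysis.FluidPDE.reflectVel n (v, w)).1, (Literature.Analysis.FluidPDE.reflectVel n (v, w)).2) = -Ψ (n, v, w)) → ∀ η δ : ℝ, 0 < η → 0 < δ → ∃ r₀ : ℝ, 0 < r₀ ∧ ∀ r ϑ : ℝ, 0 < r → r < r₀ → 0 < ϑ → ϑ < r₀ → ∃ N₀ : ℕ, ∀ N : ℕ, N₀ ≤ N → let ε := Literature.MathematicalPhysics.KineticTheory.hsDiameter σ N; let G := Literature.Analysis.FluidPDE.Torus.geometry (Fin 3); let γ := fun z (s : ℝ) => (Φ N).flow s z; let bx : UnitAddTorus (Fin 3) → UnitAddTorus (Fin 3) → ℝ := fun x y => 3 / (Real.pi * r ^ 3) * max (1 - Literature.Analysis.FluidPDE.Torus.euclidDist x y / r) 0; let ρm := fun z s (x₀ : UnitAddTorus (Fin 3)) => ∫ q, bx q.1 x₀ ∂(Literature.Analysis.FluidPDE.empiricalMeasure (γ z s)); let hm := fun z s (x₀ : UnitAddTorus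 (Fin 3)) (v : EuclideanSpace ℝ (Fin 3)) => ∫ q, bx q.1 x₀ * Literature.Analysis.FluidPDE.localMaxwellian 1 (ϑ ^ 2) v q.2 ∂(Literature.Analysis.FluidPDE.empiricalMeasure (γ z s)); let pv := fun z s (i j : Fin (N + 1)) => Literature.Analysis.FluidPDE.reflectVel (G.sepVec (γ z s i).1 (γ z s j).1) ((γ z s i).2, (γ z s j).2); let F := fun z s (i j : Fin (N + 1)) => Real.log (hm z s (γ z s i).1 (pv z s i j).1) + Real.log (hm z s (γ z s i).1 (pv z s i j).2) - Real.log (hm z s (γ z s i).1 (γ z s i).2) - Real.log (hm z s (γ z s i).1 (γ z s j).2); let Kc := fun (Fn : Literature.Analysis.FluidPDE.Config (N + 1) (Fin 3) Literature.MathematicalPhysics.KineticTheory.T3 → ℝ → Fin (N + 1) → Fin (N + 1) → ℝ) z => ε / (N + 1 : ℝ) * ∑ᶠ (s : ℝ) (_ : s ∈ Literature.Analysis.FluidPDE.collisionTimes G ε (γ z) ∩ Set.Icc 0 τ), ∑ i : Fin (N + 1), ∑ j : Fin (N + 1), (if i ≠ j ∧ ‖G.sepVec (γ z s i).1 (γ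 z s j).1‖ = ε then Fn z s i j else 0); let D := fun z => Kc (fun z s i j => χ (s, (γ z s i).1) * g (σ ^ 3 * ρm z s (γ z s i).1) * (Ψ (ε⁻¹ • G.sepVec (γ z s i).1 (γ z s j).1, (pv z s i j).1, (pv z s i j).2) * min 1 (Real.exp (-F z s i j)))) z; Literature.MathematicalPhysics.KineticTheory.localGibbsLaw σ (fun _ => 1) Summit.AtomisticToContinuum.HydrodynamicLimit.Theorems.HydroLimitInBandNegative.shearVelocity (fun _ => 1) N (Φ N) {z | η < |D z|} ≤ ENNReal.ofReal δ data, any fixed horizon, Metropolis-weighted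
  J-odd statistic.  Unlike rung 0, the incoming contact law here is NOT J-symmetric at finite `N`: the Chapman–Enskog
  deviation `f = f_LE(1 + Kn·φ₁)`, `φ₁ ∝ ∂₁u₀ · (v₀v₁)`-type, is J-ODD at contact (`φ₁ + φ₁* ≠ φ₁′ + φ₁*′`), an honest odd
  signal `≈ c·Kn·K_N[1]` measured at `0.15·Kn` on shear data (EDMD j013997, retired weight's bounded variants) — the crux
  bets that NOTHING of it survives `Kn ≍ (N+1)^{−1/3} → 0` at fixed `τ`, for every shear amplitude and every `τ`
  (viscous decay and the shear instability act on times `≳ log N`, invisible at fixed `τ`; so the frame-free statement is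
  exactly as plausible as the framed one — the frame buys nothing here either).
-/

noncomputable section

namespace Summit.AtomisticToContinuum.HydrodynamicLimit.Theorems

namespace OddContactSymmetryNegative

open Summit.AtomisticToContinuum.HydrodynamicLimit.Theses.JParityClosure
open Literature.Analysis.FluidPDE Literature.MathematicalPhysics.KineticTheory
open HydroLimitInBandNegative (shearVelocity continuous_shearVelocity isHardSphereEulerSolution_shear shear_tied)

/-- **The rev-5 crux along the stationary shear flow, every horizon.**  `OddContactSymmetry` (stmt-17722) with the
profiles specialised to `(1, shearVelocity, 1)` (`shearVelocity x = sin(2π x₁) e₀`) and the three rev-5 insertions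
(classical solution, `t = 0` LLN, `τ < T`) DELETED; the `let`-chain is byte-identical to the route declaration.  (A crux
specialisation, not a cited fact: no cite tag, nothing to relocate.) -/
def OddStatShearAllTimes : Prop :=
  ∃ η₀ : ℝ, 0 < η₀ ∧ ∃ σ₀ : ℝ, 0 < σ₀ ∧ ∀ σ : ℝ, 0 < σ → σ < σ₀ → ∀ Φ : (N : ℕ) → Literature.Analysis.FluidPDE.HardSphereFlow (Literature.Analysis.FluidPDE.Torus.geometry (Fin 3)) (Literature.MathematicalPhysics.KineticTheory.hsDiameter σ N) (N + 1), ∀ τ : ℝ, 0 < τ → ∀ χ : ℝ × UnitAddTorus (Fin 3) → ℝ, Continuous χ → ∀ g : ℝ → ℝ, Continuous g → (∀ a, η₀ ≤ a → g a = 0) → ∀ Ψ : EuclideanSpace ℝ (Fin 3) × EuclideanSpace ℝ (Fin 3) × EuclideanSpace ℝ (Fin 3) → ℝ, Continuous Ψ → (∃ C : ℝ, ∀ q, |Ψ q| ≤ C) → (∀ (n v w : EuclideanSpace ℝ (Fin 3)), ‖n‖ = 1 → Ψ (-n, (Literature.Analysis.FluidPDE.reflectVel n (v, w)).1, (Literature.Analysis.FluidPDE.reflectVel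 n (v, w)).2) = -Ψ (n, v, w)) → ∀ η δ : ℝ, 0 < η → 0 < δ → ∃ r₀ : ℝ, 0 < r₀ ∧ ∀ r ϑ : ℝ, 0 < r → r < r₀ → 0 < ϑ → ϑ < r₀ → ∃ N₀ : ℕ, ∀ N : ℕ, N₀ ≤ N → let ε := Literature.MathematicalPhysics.KineticTheory.hsDiameter σ N; let G := Literature.Analysis.FluidPDE.Torus.geometry (Fin 3); let γ := fun z (s : ℝ) => (Φ N).flow s z; let bx : UnitAddTorus (Fin 3) → UnitAddTorus (Fin 3) → ℝ := fun x y => 3 / (Real.pi * r ^ 3) * max (1 - Literature.Analysis.FluidPDE.Torus.euclidDist x y / r) 0; let ρm := fun z s (x₀ : UnitAddTorus (Fin 3)) => ∫ q, bx q.1 x₀ ∂(Literature.Analysis.FluidPDE.empiricalMeasure (γ z s)); let hm := fun z s (x₀ : UnitAddTorus (Fin 3)) (v : EuclideanSpace ℝ (Fin 3)) => ∫ q, bx q.1 x₀ * Literature.Analysis.FluidPDE.localMaxwellian 1 (ϑ ^ 2) v q.2 ∂(Literature.Analysis.FluidPDE.empiricalMeasure (γ z s)); let pv := fun z s (i j :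 Fin (N + 1)) => Literature.Analysis.FluidPDE.reflectVel (G.sepVec (γ z s i).1 (γ z s j).1) ((γ z s i).2, (γ z s j).2); let F := fun z s (i j : Fin (N + 1)) => Real.log (hm z s (γ z s i).1 (pv z s i j).1) + Real.log (hm z s (γ z s i).1 (pv z s i j).2) - Real.log (hm z s (γ z s i).1 (γ z s i).2) - Real.log (hm z s (γ z s i).1 (γ z s j).2); let Kc := fun (Fn : Literature.Analysis.FluidPDE.Config (N + 1) (Fin 3) Literature.MathematicalPhysics.KineticTheory.T3 → ℝ → Fin (N + 1) → Fin (N + 1) → ℝ) z => ε / (N + 1 : ℝ) * ∑ᶠ (s : ℝ) (_ : s ∈ Literature.Analysis.FluidPDE.collisionTimes G ε (γ z) ∩ Set.Icc 0 τ), ∑ i : Fin (N + 1), ∑ j : Fin (N + 1), (if i ≠ j ∧ ‖G.sepVec (γ z s i).1 (γ z s j).1‖ = ε then Fn z s i j else 0); let D := fun z => Kc (fun z s i j => χ (s, (γ z s i).1) * g (σ ^ 3 * ρm z s (γ z s i).1) * (Ψ (ε⁻¹ • G.sepVec (γ z s i).1 (γ z s j).1, (pv z s i j).1, (pv z s i j).2)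 * min 1 (Real.exp (-F z s i j)))) z; Literature.MathematicalPhysics.KineticTheory.localGibbsLaw σ (fun _ => 1) Summit.AtomisticToContinuum.HydrodynamicLimit.Theorems.HydroLimitInBandNegative.shearVelocity (fun _ => 1) N (Φ N) {z | η < |D z|} ≤ ENNReal.ofReal δ

/-- **The pre-shock frame is void along the shear flow**: the rev-5 crux implies its frame-free shear specialisation for
EVERY horizon `τ > 0` — instantiate `T := τ + 1`, the stationary shear solution (`isHardSphereEulerSolution_shear`) and
its `t = 0` tie (`shear_tied`), shrinking `σ₀`.  A non-equilibrium member of the crux with no Euler-existence and no LLN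
debt left. [folklore] -/
theorem oddContactSymmetry_imp_shearAllTimes (h : OddContactSymmetry) : OddStatShearAllTimes := by
  obtain ⟨η₀, hη₀, H⟩ := h
  refine ⟨η₀, hη₀, ?_⟩
  obtain ⟨σ₀, hσ₀, Hσ⟩ := H (fun _ => 1) (fun _ => 1) shearVelocity continuous_const continuous_const
    continuous_shearVelocity (fun _ => one_pos) (fun _ => one_pos)
  obtain ⟨σ₁, hσ₁, -, hL⟩ := shear_tied
  refine ⟨min σ₀ σ₁, lt_min hσ₀ hσ₁, fun σ hσ hσlt Φ τ hτ => ?_⟩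
  have hσ0 : σ < σ₀ := lt_of_lt_of_le hσlt (min_le_left _ _)
  have hσ1 : σ < σ₁ := lt_of_lt_of_le hσlt (min_le_right _ _)
  exact Hσ σ hσ hσ0 (τ + 1) (fun _ _ => 1) (fun _ _ => 1) (fun _ x => shearVelocity x)
    (isHardSphereEulerSolution_shear σ (τ + 1)) Φ (hL σ hσ hσ1 Φ) τ hτ (by linarith)

/-- **Non-equilibrium kill recipe surviving the restatement**: an anomaly of the Metropolis-weighted odd statistic along
the hard-sphere evolution of local-Gibbs ∃ η₀ : ℝ, 0 < η₀ ∧ ∃ σ₀ : ℝ, 0 < σ₀ ∧ ∀ σ : ℝ, 0 < σ → σ < σ₀ → ∀ Φ : (N : ℕ) → Literature.Analysis.FluidPDE.HardSphereFlow (Literature.Analysis.FluidPDE.Torus.geometry (Fin 3)) (Literature.MathematicalPhysics.KineticTheory.hsDiameter σ N) (N + 1), ∀ τ : ℝ, 0 < τ → ∀ χ : ℝ × UnitAddTorus (Fin 3) → ℝ, Continuous χ → ∀ g : ℝ → ℝ, Continuous g → (∀ a, η₀ ≤ a → g a = 0) → ∀ Ψ : EuclideanSpace ℝ (Fin 3)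 × EuclideanSpace ℝ (Fin 3) × EuclideanSpace ℝ (Fin 3) → ℝ, Continuous Ψ → (∃ C : ℝ, ∀ q, |Ψ q| ≤ C) → (∀ (n v w : EuclideanSpace ℝ (Fin 3)), ‖n‖ = 1 → Ψ (-n, (Literature.Analysis.FluidPDE.reflectVel n (v, w)).1, (Literature.Analysis.FluidPDE.reflectVel n (v, w)).2) = -Ψ (n, v, w)) → ∀ η δ : ℝ, 0 < η → 0 < δ → ∃ r₀ : ℝ, 0 < r₀ ∧ ∀ r ϑ : ℝ, 0 < r → r < r₀ → 0 < ϑ → ϑ < r₀ → ∃ N₀ : ℕ, ∀ N : ℕ, N₀ ≤ N → let ε := Literature.MathematicalPhysics.KineticTheory.hsDiameter σ N; let G := Literature.Analysis.FluidPDE.Torus.geometry (Fin 3); let γ := fun z (s : ℝ) => (Φ N).flow s z; let bx : UnitAddTorus (Fin 3) → UnitAddTorus (Fin 3) → ℝ := fun x y => 3 / (Real.pi * r ^ 3) * max (1 - Literature.Analysis.FluidPDE.Torus.euclidDist x y / r) 0; let ρm := fun z s (x₀ : UnitAddTorus (Fin 3)) => ∫ q, bx q.1 x₀ ∂(Literature.Analysis.FluidPDE.empiricalMeasure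 (γ z s)); let hm := fun z s (x₀ : UnitAddTorus (Fin 3)) (v : EuclideanSpace ℝ (Fin 3)) => ∫ q, bx q.1 x₀ * Literature.Analysis.FluidPDE.localMaxwellian 1 (ϑ ^ 2) v q.2 ∂(Literature.Analysis.FluidPDE.empiricalMeasure (γ z s)); let pv := fun z s (i j : Fin (N + 1)) => Literature.Analysis.FluidPDE.reflectVel (G.sepVec (γ z s i).1 (γ z s j).1) ((γ z s i).2, (γ z s j).2); let F := fun z s (i j : Fin (N + 1)) => Real.log (hm z s (γ z s i).1 (pv z s i j).1) + Real.log (hm z s (γ z s i).1 (pv z s i j).2) - Real.log (hm z s (γ z s i).1 (γ z s i).2) - Real.log (hm z s (γ z s i).1 (γ z s j).2); let Kc := fun (Fn : Literature.Analysis.FluidPDE.Config (N + 1) (Fin 3) Literature.MathematicalPhysics.KineticTheory.T3 → ℝ → Fin (N + 1) → Fin (N + 1) → ℝ) z => ε / (N + 1 : ℝ) * ∑ᶠ (s : ℝ) (_ : s ∈ Literature.Analysis.FluidPDE.collisionTimes G ε (γ z) ∩ Set.Icc 0 τ), ∑ i : Fin (N + 1), ∑ j : Fin (N + 1), (if i ≠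 j ∧ ‖G.sepVec (γ z s i).1 (γ z s j).1‖ = ε then Fn z s i j else 0); let D := fun z => Kc (fun z s i j => χ (s, (γ z s i).1) * g (σ ^ 3 * ρm z s (γ z s i).1) * (Ψ (ε⁻¹ • G.sepVec (γ z s i).1 (γ z s j).1, (pv z s i j).1, (pv z s i j).2) * min 1 (Real.exp (-F z s i j)))) z; Literature.MathematicalPhysics.KineticTheory.localGibbsLaw σ (fun _ => 1) Summit.AtomisticToContinuum.HydrodynamicLimit.Theorems.HydroLimitInBandNegative.shearVelocity (fun _ => 1) N (Φ N) {z | η < |D z|} ≤ ENNReal.ofReal δ data at some fixed horizon refutes the rev-5 crux (contrapositive of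
`oddContactSymmetry_imp_shearAllTimes`). [folklore] -/
theorem not_oddContactSymmetry_of_not_shearAllTimes (h : ¬ OddStatShearAllTimes) : ¬ OddContactSymmetry :=
  fun hc => h (oddContactSymmetry_imp_shearAllTimes hc)

end OddContactSymmetryNegative

end Summit.AtomisticToContinuum.HydrodynamicLimit.Theorems

end
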